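import Mathlib
import Summits.Schanuel.Schanuel.Theorems.AclSubsetLogFreeCore.Negative.LogFreeCoreObjects
import Literature.NumberTheory.Transcendental.ZilberFieldQuasiminimal

/-!
# Crux `RigidCore.AclSubsetLogFreeCore` (stmt-Schanuel-0968): the residue (A₀) is presentation-independent

The two EAC lines of the crux reduce (A) to Zilber's EAC plus a residue "the fixed field of the
exponential-field automorphisms of the countable core `C₀ = ecl ∅` is log-free", stated in two
presentations of `Aut_E(C₀)`:

* line `eac-extends-core-automorphisms` (`stub_coreFixedField_logFree`): maps `g : ℂ → ℂ` with
  `IsEIsoOn g (ecl ∅) (ecl ∅)` (the tree's presentation, consumed by `ZilberHomogeneity.baseEquiv`);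
* line `eac-homogeneity-collapse` (`stub_coreFixedLogFree`): bundled isomorphisms
  `ExponentialRingEquiv (Khovanskii.eclSubfield ∅) (Khovanskii.eclSubfield ∅)`.

This file proves the two residues EQUIVALENT (`coreFixedField_logFree_iff_coreFixed_logFree`), so that
the residue can be filed as ONE statement: an `IsEIsoOn` map bundles to an `ExponentialRingEquiv`
(`IsEIsoOn.equiv`, tree), and conversely a bundled automorphism `θ`, extended by the identity off the
core (`Function.extend Subtype.val (θ ·) id`), is an E-isomorphism of `ecl C` onto itself
(`isEIsoOn_extend_equiv`); hence the two fixed-point conditions on an element of the core coincide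
(`forall_isEIsoOn_fixed_iff`). Stated for an arbitrary exponential field `K` and closed set `ecl C`,
then specialised to `ℂ`, `C = ∅`.
-/

noncomputable section

open Set
open Literature.ModelTheory.ExponentialFields
open Literature.NumberTheory.Transcendental
open Summit.Schanuel.Schanuel.Theorems.AclSubsetLogFreeCore.Negative

namespace Summit.Schanuel.Schanuel.Theorems.RigidCore

section General

variable {K : Type*} [Field K] [ExponentialRing K] {C : Set K}

/-- The extension by the identity of a bundled E-automorphism `θ` of `ecl C` agrees with `θ` on
`ecl C`. -/
theorem extend_equiv_apply_of_mem
    (θ : ExponentialRingEquiv (Khovanskii.eclSubfield C) (Khovanskii.eclSubfield C))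
    {z : K} (hz : z ∈ ecl C) :
    Function.extend (Subtype.val : Khovanskii.eclSubfield C → K)
        (fun a => ((θ a : Khovanskii.eclSubfield C) : K)) id z =
      ((θ ⟨z, hz⟩ : Khovanskii.eclSubfield C) : K) :=
  Subtype.val_injective.extend_apply (fun a => ((θ a : Khovanskii.eclSubfield C) : K)) id ⟨z, hz⟩

/-- **A bundled E-automorphism of `ecl C`, extended by the identity off `ecl C`, is an
E-isomorphism of `ecl C` onto itself in the `IsEIsoOn` presentation.** -/
theorem isEIsoOn_extend_equiv
    (θ : ExponentialRingEquiv (Khovanskii.eclSubfield C) (Khovanskii.eclSubfield C)) :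
    IsEIsoOn (Function.extend (Subtype.val : Khovanskii.eclSubfield C → K)
      (fun a => ((θ a : Khovanskii.eclSubfield C) : K)) id) (ecl C) (ecl C) := by
  refine ⟨⟨fun z hz => ?_, fun u hu v hv huv => ?_, fun w hw => ?_⟩, fun u v hu hv => ?_,
    fun u v hu hv => ?_, fun u hu => ?_⟩
  · rw [extend_equiv_apply_of_mem θ hz]; exact (θ ⟨z, hz⟩).2
  · rw [extend_equiv_apply_of_mem θ hu, extend_equiv_apply_of_mem θ hv] at huv
    have h := EquivLike.injective θ (Subtype.ext huv)
    exact congrArg Subtype.val h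
  · obtain ⟨b, hb⟩ := EquivLike.surjective θ ⟨w, hw⟩
    refine ⟨(b : K), b.2, ?_⟩
    rw [extend_equiv_apply_of_mem θ b.2, Subtype.coe_eta, hb]
  · rw [extend_equiv_apply_of_mem θ hu, extend_equiv_apply_of_mem θ hv,
      extend_equiv_apply_of_mem θ (Khovanskii.add_mem_ecl hu hv)]
    have h := map_add θ ⟨u, hu⟩ ⟨v, hv⟩
    exact congrArg Subtype.val h
  · rw [extend_equiv_apply_of_mem θ hu, extend_equiv_apply_of_mem θ hv,
      extend_equiv_apply_of_mem θ (Khovanskii.mul_mem_ecl hu hv)]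
    have h := map_mul θ ⟨u, hu⟩ ⟨v, hv⟩
    exact congrArg Subtype.val h
  · rw [extend_equiv_apply_of_mem θ hu, extend_equiv_apply_of_mem θ (Khovanskii.exp_mem_ecl hu)]
    have h := θ.map_exp ⟨u, hu⟩
    exact congrArg Subtype.val h

/-- **The two fixed-point conditions coincide**: an element of `ecl C` is fixed by every map
`g : K → K` which is an E-isomorphism of `ecl C` onto itself iff it is fixed by every bundled
E-automorphism of the E-subfield `ecl C`. -/
theorem forall_isEIsoOn_fixed_iff {a : K} (ha : a ∈ ecl C) :
    (∀ g : K → K, IsEIsoOn g (ecl C) (ecl C) → g a = a) ↔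
      ∀ θ : ExponentialRingEquiv (Khovanskii.eclSubfield C) (Khovanskii.eclSubfield C),
        θ ⟨a, ha⟩ = ⟨a, ha⟩ := by
  constructor
  · intro h θ
    apply Subtype.ext
    have h1 := h _ (isEIsoOn_extend_equiv θ)
    rwa [extend_equiv_apply_of_mem θ ha] at h1
  · intro h g hg
    have h1 := congrArg Subtype.val (h hg.equiv)
    simpa only [IsEIsoOn.coe_equiv_apply] using h1

end General

/-- **The residue (A₀) is presentation-independent**: `stub_coreFixedField_logFree` of line
`eac-extends-core-automorphisms` (fixed field of `Aut_E(ecl ∅)` presented by `IsEIsoOn` maps is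
log-free) is EQUIVALENT to `stub_coreFixedLogFree` of line `eac-homogeneity-collapse` (the same over
bundled `ExponentialRingEquiv`s of `Khovanskii.eclSubfield ∅`). -/
theorem coreFixedField_logFree_iff_coreFixed_logFree :
    (∀ a ∈ ecl (∅ : Set ℂ),
      (∀ g : ℂ → ℂ, IsEIsoOn g (ecl (∅ : Set ℂ)) (ecl (∅ : Set ℂ)) → g a = a) →
        a ∈ (logFreeCore : Set ℂ)) ↔
    (∀ a : Khovanskii.eclSubfield (∅ : Set ℂ),
      (∀ θ : ExponentialRingEquiv (Khovanskii.eclSubfield (∅ : Set ℂ))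
        (Khovanskii.eclSubfield (∅ : Set ℂ)), θ a = a) → (a : ℂ) ∈ logFreeCore) := by
  constructor
  · intro h a hfix
    exact h a a.2 ((forall_isEIsoOn_fixed_iff a.2).2 fun θ => by simpa using hfix θ)
  · intro h a ha hfix
    exact h ⟨a, ha⟩ ((forall_isEIsoOn_fixed_iff ha).1 hfix)

end Summit.Schanuel.Schanuel.Theorems.RigidCore
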